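import Literature.GroupTheory.Abelian.EmbeddingInProductOfCyclicGroups
import HarnessLib

/-!
# Route `GenusKolyvaginAtTwo`, crux L_T `PowDvdShaCardAtTwoRT` (stmt-BirchSwinnertonDyer-23242), LINE 18 stub 3a⁗ —
# I4′: the KLEIN CRITERION for simultaneous non-vanishing of three order-`2` classes under a `ℤ/2^M`-valued character,
# and the full-order prescriptions of the two-prime engine

LEAD seat `bsd-line-gk2-p1` g15 (cell `bsd-f1-sign2`), `--supports stmt-BirchSwinnertonDyer-23242` (helper). Pure algebra over
`Literature.GroupTheory.Abelian.Purity.exists_addMonoidHom_zmod_pow_ne_zero` (characters `G → ℤ/pⁿ` detect `pⁿG`); THEOREMS ONLY.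
BSD is not proved by this file; neither is the crux or the stub.

WHY (memo `Cruxes/PowDvdShaCardAtTwoRT/Lines/plus-descent-lead-g15.md`, §2.4). On `Δ(E) < 0` the Frobenius homomorphisms realisable
at Kolyvagin primes of level `≥ M` on a finite `τ`-stable subgroup `𝒞 ⊂ H¹(K, E[2^M])` are ALL of `Hom_{C₂}(𝒞, E[2^M]) ≅ Hom(𝒞, ℤ/2^M)`
(McCallum Prop. 3.1 at `2`: the realisable set is a coset of the norms, and `Ĥ⁰(C₂, Hom(𝒞, R_M)) = 0` since `E[2^M] ≅ R_M` is free —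
route item Q1; the tree's `GenusExact.equivariantChebotarevAtTwo_eigen_of_not_isSquare` is the INDEPENDENT-family case). A
prescription «the `τ`-eigen class `x` of order `2^A` has FULL local order at `λ′`» reads `χ(x)` has order `2^A`, i.e.
`χ(2^{A−1}x) ≠ 0` — a condition on the ORDER-2 BOTTOM `2^{A−1}x` only (§2); a detection «`c_{λ′} ≠ 0`» for `c` of order `2` reads
`χ(c) ≠ 0`. The two-prime swap (`…RTTwoPrimeSwap`, input `hceb`) wants all three at once for `{c_M(n/ℓ₀), c_M(n), c*}`. THIS FILE:
for non-zero `2`-torsion `b₁, b₂, b₃` in a group killed by `2^M`,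
**`(∃ χ : G →+ ℤ/2^M, χ b₁ ≠ 0 ∧ χ b₂ ≠ 0 ∧ χ b₃ ≠ 0) ⟺ b₁ + b₂ + b₃ ≠ 0`** (`exists_addMonoidHom_ne_zero_three_iff`) — the ONLY
obstruction is the Klein coincidence `b₃ = b₁ + b₂` (with `b₁ ≠ b₂`); two classes are never obstructed
(`exists_addMonoidHom_ne_zero_pair`: a group is not the union of two proper subgroups). Hence (§3) the I4′ targets exist iff
`2^{A₁−1}x₁ + 2^{A₂−1}x₂ + c* ≠ 0` (`exists_addMonoidHom_fullOrder_pair_and_ne_zero`) — equal bottoms are harmless, and for an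
independent triple the condition holds trivially. This replaces the «Klein-four obstruction» of gk2-p2 g15's memo §2 (diagnosed
for McCallum's auxiliary class, which the two-prime engine no longer uses) by its exact residue.

References: [McCallumLMS1991] §3 (2), Prop. 3.1, Cor. 3.2 (p. 309: «a finite group cannot be the union of two proper subgroups»);
[Scorza1926] (a group is a union of three proper subgroups iff it has a Klein-four quotient); [Kaplansky1954] §9 Ex. 20 (characters
detect `pⁿG`).
-/

set_option autoImplicit false
-- `Summit.<P>.<Sub>` repeats `BirchSwinnertonDyer` by the tree's layout convention (D-0017)
set_option linter.dupNamespace false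

namespace Summit.BirchSwinnertonDyer.BirchSwinnertonDyer.Theorems.GenusExact.PlusDescent

open Literature.GroupTheory.Abelian.Purity

section Klein

variable {G : Type*} [AddCommGroup G] {M : ℕ}

/-- In `ℤ/2^M` two NON-ZERO elements killed by `2` coincide (the `2`-torsion of a cyclic `2`-group has order `≤ 2`). [folklore] -/
theorem zmod_eq_of_two_nsmul_eq_zero {y y' : ZMod (2 ^ M)} (hy : 2 • y = 0) (hy' : 2 • y' = 0) (h0 : y ≠ 0) (h0' : y' ≠ 0) :
    y = y' := by
  -- both have `val = 2^(M-1)`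
  have hM : M ≠ 0 := by
    rintro rfl
    haveI : Subsingleton (ZMod (2 ^ 0)) := by change Subsingleton (ZMod 1); infer_instance
    exact h0 (Subsingleton.elim _ _)
  haveI : NeZero (2 ^ M) := ⟨pow_ne_zero M two_ne_zero⟩
  have key : ∀ {z : ZMod (2 ^ M)}, 2 • z = 0 → z ≠ 0 → z.val = 2 ^ (M - 1) := by
    intro z hz hz0
    have hlt : z.val < 2 ^ M := ZMod.val_lt z
    have hcast : ((2 * z.val : ℕ) : ZMod (2 ^ M)) = 0 := by
      rw [Nat.cast_mul, Nat.cast_ofNat, ZMod.natCast_zmod_val, two_mul, ← two_nsmul, hz]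
    have hdvd : 2 ^ M ∣ 2 * z.val := (ZMod.natCast_eq_zero_iff _ _).mp hcast
    have hM1 : 2 ^ M = 2 * 2 ^ (M - 1) := by
      rw [← pow_succ']; congr 1; omega
    have hlt' : z.val < 2 * 2 ^ (M - 1) := by rw [← hM1]; exact hlt
    have hdvd' : 2 * 2 ^ (M - 1) ∣ 2 * z.val := by rw [← hM1]; exact hdvd
    obtain ⟨k, hk⟩ := Nat.dvd_of_mul_dvd_mul_left two_pos hdvd'
    have hzv : z.val ≠ 0 := fun h ↦ hz0 ((ZMod.val_eq_zero z).mp h)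
    have hpos : 0 < 2 ^ (M - 1) := Nat.two_pow_pos _
    have hk2 : k < 2 := by
      by_contra hk2
      push Not at hk2
      have : 2 * 2 ^ (M - 1) ≤ 2 ^ (M - 1) * k := by
        rw [mul_comm]; exact Nat.mul_le_mul_left _ hk2
      omega
    have hk0 : k ≠ 0 := fun h ↦ hzv (by rw [hk, h, mul_zero])
    have hk1 : k = 1 := by omega
    rw [hk, hk1, mul_one]
  exact ZMod.val_injective _ ((key hy h0).trans (key hy' h0').symm)

/-- A character's value at a `2`-torsion element is `2`-torsion. [folklore] -/
theorem two_nsmul_apply_eq_zero (χ : G →+ ZMod (2 ^ M)) {b : G} (hb : 2 • b = 0) : 2 • χ b = 0 := by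
  rw [← map_nsmul, hb, map_zero]

/-- **XOR law**: for `2`-torsion `b` and characters `χ, χ′`, `(χ + χ′)(b) ≠ 0 ⟺ (χ b = 0 ⟺ χ′ b ≠ 0)` — exactly one of the two values is
non-zero (two non-zero `2`-torsion values of `ℤ/2^M` coincide and cancel). [folklore] -/
theorem add_apply_ne_zero_iff (χ χ' : G →+ ZMod (2 ^ M)) {b : G} (hb : 2 • b = 0) :
    (χ + χ') b ≠ 0 ↔ (χ b = 0 ↔ χ' b ≠ 0) := by
  rw [AddMonoidHom.add_apply]
  by_cases h1 : χ b = 0 <;> by_cases h2 : χ' b = 0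
  · simp [h1, h2]
  · simp [h1, h2]
  · simp [h1, h2]
  · have heq := zmod_eq_of_two_nsmul_eq_zero (two_nsmul_apply_eq_zero χ hb) (two_nsmul_apply_eq_zero χ' hb) h1 h2
    rw [heq, ← two_nsmul, two_nsmul_apply_eq_zero χ' hb]
    simp [h2]

/-- Characters `G → ℤ/2^M` separate points when `2^M G = 0`. [cite: Kaplansky1954, §9 Exercise 20] -/
theorem exists_addMonoidHom_ne_zero (h2M : ∀ x : G, 2 ^ M • x = 0) {b : G} (hb : b ≠ 0) :
    ∃ χ : G →+ ZMod (2 ^ M), χ b ≠ 0 := by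
  refine exists_addMonoidHom_zmod_pow_ne_zero Nat.prime_two fun ⟨x, hx⟩ ↦ hb ?_
  rw [← hx, nsmulAddMonoidHom_apply, h2M]

/-- **Two classes are never obstructed** («a finite group cannot be the union of two proper subgroups», McCallum p. 309): for non-zero
`2`-torsion `b, b′` there is `χ` with `χ b ≠ 0` and `χ b′ ≠ 0`. [cite: McCallumLMS1991, §5 Prop. 5.2 (proof, p. 309)] -/
theorem exists_addMonoidHom_ne_zero_pair (h2M : ∀ x : G, 2 ^ M • x = 0) {b b' : G} (hb : b ≠ 0) (hb' : b' ≠ 0)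
    (h2b : 2 • b = 0) (h2b' : 2 • b' = 0) :
    ∃ ψ : G →+ ZMod (2 ^ M), ψ b ≠ 0 ∧ ψ b' ≠ 0 := by
  obtain ⟨χ, hχ⟩ := exists_addMonoidHom_ne_zero h2M hb
  obtain ⟨χ', hχ'⟩ := exists_addMonoidHom_ne_zero h2M hb'
  by_cases h1 : χ b' = 0
  · by_cases h2 : χ' b = 0
    · refine ⟨χ + χ', ?_, ?_⟩
      · exact (add_apply_ne_zero_iff χ χ' h2b).mpr ⟨fun h ↦ absurd h hχ, fun h ↦ absurd h2 h⟩
      · exact (add_apply_ne_zero_iff χ χ' h2b').mpr ⟨fun _ ↦ hχ', fun _ ↦ h1⟩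
    · exact ⟨χ', h2, hχ'⟩
  · exact ⟨χ, hχ, h1⟩

/-- **THE KLEIN CRITERION (I4′).** For non-zero `2`-torsion `b₁, b₂, b₃` in a group killed by `2^M`:
**some `χ : G →+ ℤ/2^M` has `χ b₁ ≠ 0`, `χ b₂ ≠ 0`, `χ b₃ ≠ 0` iff `b₁ + b₂ + b₃ ≠ 0`** — the only obstruction to three simultaneous
non-vanishings is the Klein coincidence `b₃ = b₁ + b₂`, `b₁ ≠ b₂` (then `χ b₃ = χ b₁ + χ b₂ = 0` whenever both are non-zero).
[cite: McCallumLMS1991, §3 Prop. 3.1, Cor. 3.2; §5 Prop. 5.2 (proof, (10)–(12))] -/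
theorem exists_addMonoidHom_ne_zero_three_iff (h2M : ∀ x : G, 2 ^ M • x = 0) {b₁ b₂ b₃ : G}
    (hb₁ : b₁ ≠ 0) (hb₂ : b₂ ≠ 0) (hb₃ : b₃ ≠ 0) (h2b₁ : 2 • b₁ = 0) (h2b₂ : 2 • b₂ = 0) (h2b₃ : 2 • b₃ = 0) :
    (∃ χ : G →+ ZMod (2 ^ M), χ b₁ ≠ 0 ∧ χ b₂ ≠ 0 ∧ χ b₃ ≠ 0) ↔ b₁ + b₂ + b₃ ≠ 0 := by
  constructor
  · -- three non-zero `2`-torsion values sum to a non-zero value (`h + h + h = h`)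
    rintro ⟨χ, h1, h2, h3⟩ hsum
    have h12 := zmod_eq_of_two_nsmul_eq_zero (two_nsmul_apply_eq_zero χ h2b₁) (two_nsmul_apply_eq_zero χ h2b₂) h1 h2
    have h : χ (b₁ + b₂ + b₃) = χ b₃ := by
      rw [map_add, map_add, h12, ← two_nsmul, two_nsmul_apply_eq_zero χ h2b₂, zero_add]
    rw [hsum, map_zero] at h
    exact h3 h.symm
  · intro hsum
    by_contra hno
    push Not at hno
    -- pairwise witnesses
    obtain ⟨ψ, hψ1, hψ2⟩ := exists_addMonoidHom_ne_zero_pair h2M hb₁ hb₂ h2b₁ h2b₂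
    have hψ3 : ψ b₃ = 0 := hno ψ hψ1 hψ2
    obtain ⟨ψ', hψ'1, hψ'3⟩ := exists_addMonoidHom_ne_zero_pair h2M hb₁ hb₃ h2b₁ h2b₃
    have hψ'2 : ψ' b₂ = 0 := by
      by_contra h; exact hψ'3 (hno ψ' hψ'1 h)
    obtain ⟨ψ'', hψ''2, hψ''3⟩ := exists_addMonoidHom_ne_zero_pair h2M hb₂ hb₃ h2b₂ h2b₃
    have hψ''1 : ψ'' b₁ = 0 := by
      by_contra h; exact hψ''3 (hno ψ'' h hψ''2)
    -- every character has an EVEN non-vanishing pattern on `{b₁, b₂, b₃}`, hence kills `b₁ + b₂ + b₃`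
    have heven : ∀ χ : G →+ ZMod (2 ^ M), χ (b₁ + b₂ + b₃) = 0 := by
      intro χ
      rw [map_add, map_add]
      by_cases c1 : χ b₁ = 0 <;> by_cases c2 : χ b₂ = 0 <;> by_cases c3 : χ b₃ = 0
      · rw [c1, c2, c3, add_zero, add_zero]
      · -- pattern (0,0,1): `χ + ψ` has pattern (1,1,1)
        exfalso
        exact ((add_apply_ne_zero_iff χ ψ h2b₃).mpr ⟨fun h ↦ absurd h c3, fun h ↦ absurd hψ3 h⟩)
          (hno (χ + ψ) ((add_apply_ne_zero_iff χ ψ h2b₁).mpr ⟨fun _ ↦ hψ1, fun _ ↦ c1⟩)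
            ((add_apply_ne_zero_iff χ ψ h2b₂).mpr ⟨fun _ ↦ hψ2, fun _ ↦ c2⟩))
      · -- pattern (0,1,0): `χ + ψ'`
        exfalso
        exact ((add_apply_ne_zero_iff χ ψ' h2b₃).mpr ⟨fun _ ↦ hψ'3, fun _ ↦ c3⟩)
          (hno (χ + ψ') ((add_apply_ne_zero_iff χ ψ' h2b₁).mpr ⟨fun _ ↦ hψ'1, fun _ ↦ c1⟩)
            ((add_apply_ne_zero_iff χ ψ' h2b₂).mpr ⟨fun h ↦ absurd h c2, fun h ↦ absurd hψ'2 h⟩))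
      · -- pattern (0,1,1): two equal non-zero values
        rw [c1, zero_add, zmod_eq_of_two_nsmul_eq_zero (two_nsmul_apply_eq_zero χ h2b₂)
          (two_nsmul_apply_eq_zero χ h2b₃) c2 c3, ← two_nsmul, two_nsmul_apply_eq_zero χ h2b₃]
      · -- pattern (1,0,0): `χ + ψ''`
        exfalso
        exact ((add_apply_ne_zero_iff χ ψ'' h2b₃).mpr ⟨fun _ ↦ hψ''3, fun _ ↦ c3⟩)
          (hno (χ + ψ'') ((add_apply_ne_zero_iff χ ψ'' h2b₁).mpr ⟨fun h ↦ absurd h c1, fun h ↦ absurd hψ''1 h⟩)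
            ((add_apply_ne_zero_iff χ ψ'' h2b₂).mpr ⟨fun _ ↦ hψ''2, fun _ ↦ c2⟩))
      · -- pattern (1,0,1)
        rw [c2, add_zero, zmod_eq_of_two_nsmul_eq_zero (two_nsmul_apply_eq_zero χ h2b₁)
          (two_nsmul_apply_eq_zero χ h2b₃) c1 c3, ← two_nsmul, two_nsmul_apply_eq_zero χ h2b₃]
      · -- pattern (1,1,0)
        rw [c3, add_zero, zmod_eq_of_two_nsmul_eq_zero (two_nsmul_apply_eq_zero χ h2b₁)
          (two_nsmul_apply_eq_zero χ h2b₂) c1 c2, ← two_nsmul, two_nsmul_apply_eq_zero χ h2b₂]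
      · -- pattern (1,1,1): excluded
        exact (c3 (hno χ c1 c2)).elim
    obtain ⟨χ₄, hχ₄⟩ := exists_addMonoidHom_ne_zero h2M hsum
    exact hχ₄ (heven χ₄)

end Klein

/-! ## §2 Full order ⟺ the bottom is detected -/

section Bottom

variable {G H : Type*} [AddCommGroup G] [AddCommGroup H]

/-- The BOTTOM `2^(A−1)•x` of an element of order `2^A` (`A ≥ 1`) is non-zero and killed by `2`. [folklore] -/
theorem bottom_ne_zero_and_two_nsmul {x : G} {A : ℕ} (hA : 1 ≤ A) (hx : addOrderOf x = 2 ^ A) :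
    2 ^ (A - 1) • x ≠ 0 ∧ 2 • (2 ^ (A - 1) • x) = 0 := by
  constructor
  · intro h
    have hdvd : addOrderOf x ∣ 2 ^ (A - 1) := addOrderOf_dvd_of_nsmul_eq_zero h
    rw [hx, Nat.pow_dvd_pow_iff_le_right one_lt_two] at hdvd
    omega
  · rw [smul_smul, ← pow_succ', show A - 1 + 1 = A by omega, ← hx, addOrderOf_nsmul_eq_zero]

/-- **Full order ⟺ the bottom is detected.** For `x` of order `2^A` (`A ≥ 1`) and an additive map `χ` into any group:
`addOrderOf (χ x) = 2^A ⟺ χ (2^(A−1)•x) ≠ 0`. [folklore] -/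
theorem addOrderOf_apply_eq_iff_apply_bottom_ne_zero (χ : G →+ H) {x : G} {A : ℕ} (hA : 1 ≤ A) (hx : addOrderOf x = 2 ^ A) :
    addOrderOf (χ x) = 2 ^ A ↔ χ (2 ^ (A - 1) • x) ≠ 0 := by
  haveI : Fact (Nat.Prime 2) := ⟨Nat.prime_two⟩
  have hfin : 2 ^ A • χ x = 0 := by rw [← map_nsmul, ← hx, addOrderOf_nsmul_eq_zero, map_zero]
  constructor
  · intro h hb
    rw [map_nsmul] at hb
    have hdvd : addOrderOf (χ x) ∣ 2 ^ (A - 1) := addOrderOf_dvd_of_nsmul_eq_zero hb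
    rw [h, Nat.pow_dvd_pow_iff_le_right one_lt_two] at hdvd
    omega
  · intro hb
    rw [map_nsmul] at hb
    obtain ⟨n, rfl⟩ : ∃ n, A = n + 1 := ⟨A - 1, by omega⟩
    rw [Nat.add_sub_cancel] at hb
    exact addOrderOf_eq_prime_pow hb hfin

end Bottom

/-! ## §3 The I4′ targets: full order for two classes and detection of a third -/

section Targets

variable {G : Type*} [AddCommGroup G] {M : ℕ}

/-- **I4′ TARGETS.** In a group killed by `2^M`, for `x₁` of order `2^{A₁}`, `x₂` of order `2^{A₂}` (`A_i ≥ 1`) and `c ≠ 0` with `2c = 0`,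
there is `χ : G →+ ℤ/2^M` with `χ x₁` of order `2^{A₁}`, `χ x₂` of order `2^{A₂}` and `χ c ≠ 0` **iff the bottoms do not add up to
`c`: `2^{A₁−1}x₁ + 2^{A₂−1}x₂ + c ≠ 0`.** Equal bottoms are harmless; an independent triple always qualifies. These are the
prescriptions of the two-prime swap at `λ′` (`…RTTwoPrimeSwap`, `hceb`) for `{c_M(n/ℓ₀), c_M(n), c*}` read through McCallum's (2)/(3).
[cite: McCallumLMS1991, §3 Cor. 3.2; §5 Prop. 5.2 (proof, (10)–(12))] -/
theorem exists_addMonoidHom_fullOrder_pair_and_ne_zero_iff (h2M : ∀ x : G, 2 ^ M • x = 0) {x₁ x₂ c : G} {A₁ A₂ : ℕ}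
    (hA₁ : 1 ≤ A₁) (hA₂ : 1 ≤ A₂) (hx₁ : addOrderOf x₁ = 2 ^ A₁) (hx₂ : addOrderOf x₂ = 2 ^ A₂) (hc : c ≠ 0) (h2c : 2 • c = 0) :
    (∃ χ : G →+ ZMod (2 ^ M), addOrderOf (χ x₁) = 2 ^ A₁ ∧ addOrderOf (χ x₂) = 2 ^ A₂ ∧ χ c ≠ 0) ↔
      2 ^ (A₁ - 1) • x₁ + 2 ^ (A₂ - 1) • x₂ + c ≠ 0 := by
  obtain ⟨hb₁, h2b₁⟩ := bottom_ne_zero_and_two_nsmul hA₁ hx₁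
  obtain ⟨hb₂, h2b₂⟩ := bottom_ne_zero_and_two_nsmul hA₂ hx₂
  rw [← exists_addMonoidHom_ne_zero_three_iff h2M hb₁ hb₂ hc h2b₁ h2b₂ h2c]
  exact exists_congr fun χ ↦ by
    rw [addOrderOf_apply_eq_iff_apply_bottom_ne_zero χ hA₁ hx₁, addOrderOf_apply_eq_iff_apply_bottom_ne_zero χ hA₂ hx₂]

/-- **I4′ targets, two classes only** (no detection): always available. [cite: McCallumLMS1991, §3 Cor. 3.2] -/
theorem exists_addMonoidHom_fullOrder_pair (h2M : ∀ x : G, 2 ^ M • x = 0) {x₁ x₂ : G} {A₁ A₂ : ℕ}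
    (hA₁ : 1 ≤ A₁) (hA₂ : 1 ≤ A₂) (hx₁ : addOrderOf x₁ = 2 ^ A₁) (hx₂ : addOrderOf x₂ = 2 ^ A₂) :
    ∃ χ : G →+ ZMod (2 ^ M), addOrderOf (χ x₁) = 2 ^ A₁ ∧ addOrderOf (χ x₂) = 2 ^ A₂ := by
  obtain ⟨hb₁, h2b₁⟩ := bottom_ne_zero_and_two_nsmul hA₁ hx₁
  obtain ⟨hb₂, h2b₂⟩ := bottom_ne_zero_and_two_nsmul hA₂ hx₂
  obtain ⟨ψ, h1, h2⟩ := exists_addMonoidHom_ne_zero_pair h2M hb₁ hb₂ h2b₁ h2b₂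
  exact ⟨ψ, (addOrderOf_apply_eq_iff_apply_bottom_ne_zero _ hA₁ hx₁).mpr h1,
    (addOrderOf_apply_eq_iff_apply_bottom_ne_zero _ hA₂ hx₂).mpr h2⟩

end Targets

end Summit.BirchSwinnertonDyer.BirchSwinnertonDyer.Theorems.GenusExact.PlusDescent
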